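import Summits.AtomisticToContinuum.Crystallization.Theorems.OverbindingBudgetAffineTaylorCellQuadratic

/-!
# OverbindingBudget — Taylor-model cells for the far-window certificate, part 7/16 «Row»

MODULE PLAN (lens-4 g68, at hand-2's landing-shape request of 2026-09-02T14:19Z, critic row 1199 (II)) of the VERIFIED g67 leaf
`OverbindingBudgetAffineTaylorCell.lean` (sha256 `dabedef39e0c5fd2…`, 4214 l, critic row 1196): this module = leaf l.1660–1882
(§8 the certificate row (order 4) and chunked accumulation), body VERBATIM except as listed in `MAP.md`.
Same namespace `…Theorems.OverbindingBudgetAffineTaylorCell` in all 16 parts (declaration names unchanged); the parts import each other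
linearly.  No `sorry`, no `native_decide`, standard axioms; no instances/notation; scoped `set_option maxHeartbeats` with explicit bounds only.
-/

namespace Summit.AtomisticToContinuum.Crystallization.Theorems.OverbindingBudgetAffineTaylorCell

/-! ## §8 The Taylor-cell certificate row: ONE kernel check per cell, and its soundness

A row = a cell `C` (centre Gram `Gc`, box `h`, step `1/D`, order `J = 4`), the far constants `A, B`, far-field
enclosures `F6hi ≥ far₃ ≥ 0`, `far₆ ≥ F12lo` valid on the cell, and `LDLᵀ` data `P` for the degree-2 part.
`check` accumulates the order-4 models of `Σ N^{-3}` and `Σ N^{-6}` over the family, forms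
`W = P₃ + ρ₃ + F6hi ⊒ six-sum`, `V = P₆ − ρ₆ + F12lo ⊑ twelve-sum`, the truncated slot product `W·W`, the certificate
polynomial `Q = A·V − B·(W·W)`, and tests `q₀ − corner(Q) − boxLoss(Q₂ − LDLᵀ) − B·drop ≥ 0`.
`check_sound`: then `B·(six)² ≤ A·(twelve)` at EVERY real point of the box. -/

/-- `Cell.withM` (docstring added by the landing lane; see the module docstring). [formal bookkeeping] -/
def Cell.withM (C : Cell) (k : ℕ) : Cell := { C with m := k }

/-- `CertRow` (docstring added by the landing lane; see the module docstring). [formal bookkeeping] -/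
structure CertRow where
  C : Cell
  A : ℚ
  B : ℚ
  F6hi : ℚ
  F12lo : ℚ
  P : PSDCert

/-- `CertRow.acc3` (docstring added by the landing lane; see the module docstring). [formal bookkeeping] -/
def CertRow.acc3 (R : CertRow) (vs : List (ℤ × ℤ × ℤ)) : Acc := (R.C.withM 3).acc vs
/-- `CertRow.acc6` (docstring added by the landing lane; see the module docstring). [formal bookkeeping] -/
def CertRow.acc6 (R : CertRow) (vs : List (ℤ × ℤ × ℤ)) : Acc := (R.C.withM 6).acc vs
/-- Model-error radius of an accumulation: rounded remainders + slot rounding. -/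
def CertRow.rho (R : CertRow) (vs : List (ℤ × ℤ × ℤ)) (a : Acc) : ℚ := a.rem + 126 * ((vs.length : ℚ) / R.C.D)
/-- `CertRow.W` (docstring added by the landing lane; see the module docstring). [formal bookkeeping] -/
def CertRow.W (R : CertRow) (vs : List (ℤ × ℤ × ℤ)) : List ℚ :=
  addConst (R.acc3 vs).coef (R.rho vs (R.acc3 vs) + R.F6hi)
/-- `CertRow.V` (docstring added by the landing lane; see the module docstring). [formal bookkeeping] -/
def CertRow.V (R : CertRow) (vs : List (ℤ × ℤ × ℤ)) : List ℚ :=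
  addConst (R.acc6 vs).coef (R.F12lo - R.rho vs (R.acc6 vs))
/-- `CertRow.Q` (docstring added by the landing lane; see the module docstring). [formal bookkeeping] -/
def CertRow.Q (R : CertRow) (vs : List (ℤ × ℤ × ℤ)) : List ℚ :=
  linComb R.A R.B (R.V vs) (slotProdF (R.W vs) (R.W vs))
/-- The margin as a function of the two slot lists `W ⊒ six`, `V ⊑ twelve` (so that a row can MATERIALISE `W, V` as kernel-verified
literals and run the polynomial part as a separate, shallow kernel job). -/
def CertRow.marginOf (R : CertRow) (W V : List ℚ) : ℚ :=
  (linComb R.A R.B V (slotProdF W W))[0]! - cornerSum R.C (linComb R.A R.B V (slotProdF W W))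
    - ((qfOfList (linComb R.A R.B V (slotProdF W W))).sub R.P.qf).boxLoss R.C - R.B * slotProdDropF R.C W W
/-- `CertRow.margin` (docstring added by the landing lane; see the module docstring). [formal bookkeeping] -/
def CertRow.margin (R : CertRow) (vs : List (ℤ × ℤ × ℤ)) : ℚ :=
  (R.Q vs)[0]! - cornerSum R.C (R.Q vs) - ((qfOfList (R.Q vs)).sub R.P.qf).boxLoss R.C
    - R.B * slotProdDropF R.C (R.W vs) (R.W vs)

/-- `CertRow.margin_eq` (docstring added by the landing lane; see the module docstring). [formal bookkeeping] -/
theorem CertRow.margin_eq (R : CertRow) (vs : List (ℤ × ℤ × ℤ)) : R.margin vs = R.marginOf (R.W vs) (R.V vs) := rfl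

/-- `CertRow.Q_eq` (docstring added by the landing lane; see the module docstring). [formal bookkeeping] -/
theorem CertRow.Q_eq (R : CertRow) (vs : List (ℤ × ℤ × ℤ)) :
    R.Q vs = linComb R.A R.B (R.V vs) (slotProd (R.W vs) (R.W vs)) := by
  unfold CertRow.Q; rw [slotProdF_eq]

/-- THE CELL CHECK (kernel-decidable). -/
def CertRow.check (R : CertRow) (vs : List (ℤ × ℤ × ℤ)) : Bool :=
  decide ((R.acc3 vs).ok = true ∧ (R.acc6 vs).ok = true ∧ R.C.J = 4 ∧ 0 < R.C.D ∧ R.C.h1 ≤ 1 ∧ R.C.h2 ≤ 1 ∧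
    R.C.h3 ≤ 1 ∧ R.C.h4 ≤ 1 ∧ R.C.h5 ≤ 1 ∧ 0 ≤ R.A ∧ 0 ≤ R.B ∧ R.P.dOK = true ∧ 0 ≤ R.margin vs)

/-- Assemble the row check from separately kernel-decided pieces (each piece = one bounded kernel job). -/
theorem CertRow.check_of (R : CertRow) (vs : List (ℤ × ℤ × ℤ)) (h3 : (R.acc3 vs).ok = true)
    (h6 : (R.acc6 vs).ok = true)
    (hside : decide (R.C.J = 4 ∧ 0 < R.C.D ∧ R.C.h1 ≤ 1 ∧ R.C.h2 ≤ 1 ∧ R.C.h3 ≤ 1 ∧ R.C.h4 ≤ 1 ∧ R.C.h5 ≤ 1 ∧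
      0 ≤ R.A ∧ 0 ≤ R.B ∧ R.P.dOK = true) = true)
    (hm : decide (0 ≤ R.margin vs) = true) : R.check vs = true := by
  have hs := of_decide_eq_true hside
  have hm' := of_decide_eq_true hm
  unfold CertRow.check
  exact decide_eq_true ⟨h3, h6, hs.1, hs.2.1, hs.2.2.1, hs.2.2.2.1, hs.2.2.2.2.1, hs.2.2.2.2.2.1, hs.2.2.2.2.2.2.1,
    hs.2.2.2.2.2.2.2.1, hs.2.2.2.2.2.2.2.2.1, hs.2.2.2.2.2.2.2.2.2, hm'⟩

/-! ### Chunked accumulation: the coefficient table of a large family as the slotwise sum of per-chunk tables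
(each chunk table is one bounded kernel job; the full 954-vector table in ONE job exhausts kernel memory). -/

/-- Slotwise sum of slot lists. -/
def slotSum : List (List ℚ) → List ℚ
  | [] => monos.map fun _ => 0
  | T :: Ts => List.zipWith (· + ·) T (slotSum Ts)

/-- `slotSum_map` (docstring added by the landing lane; see the module docstring). [formal bookkeeping] -/
theorem slotSum_map {α : Type*} (L : List α) (g : α → Mono → ℚ) :
    slotSum (L.map fun a => monos.map (g a)) = monos.map fun mo => (L.map fun a => g a mo).sum := by
  induction L with
  | nil => simp [slotSum]
  | cons a L ih =>
    simp only [List.map_cons, slotSum]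
    rw [ih, zipWith_map_map]
    apply List.map_congr_left; intro mo _
    simp

/-- `Cell.acc_coef_flatten` (docstring added by the landing lane; see the module docstring). [formal bookkeeping] -/
theorem Cell.acc_coef_flatten (C : Cell) (L : List (List (ℤ × ℤ × ℤ))) :
    (C.acc L.flatten).coef = slotSum (L.map fun l => (C.acc l).coef) := by
  rw [C.acc_coef]
  have e : (L.map fun l => (C.acc l).coef) = L.map fun l => monos.map fun mo => (l.map fun N => C.rc N mo).sum := by
    apply List.map_congr_left; intro l _; rw [C.acc_coef]
  rw [e, slotSum_map]
  apply List.map_congr_left; intro mo _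
  rw [List.map_flatten, List.sum_flatten, List.map_map]; rfl

/-- `W` of a chunked family from the per-chunk tables `T` and the (cheap, directly kernel-evaluated) remainder `r`. -/
theorem CertRow.W_of_chunks (R : CertRow) (L : List (List (ℤ × ℤ × ℤ))) (T : List (List ℚ))
    (hT : L.map (fun l => ((R.C.withM 3).acc l).coef) = T) (r : ℚ) (hr : (R.acc3 L.flatten).rem = r) :
    R.W L.flatten = addConst (slotSum T) (r + 126 * ((L.flatten.length : ℚ) / R.C.D) + R.F6hi) := by
  unfold CertRow.W CertRow.rho
  rw [← hT, ← Cell.acc_coef_flatten, hr]; rfl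

/-- `CertRow.V_of_chunks` (docstring added by the landing lane; see the module docstring). [formal bookkeeping] -/
theorem CertRow.V_of_chunks (R : CertRow) (L : List (List (ℤ × ℤ × ℤ))) (T : List (List ℚ))
    (hT : L.map (fun l => ((R.C.withM 6).acc l).coef) = T) (r : ℚ) (hr : (R.acc6 L.flatten).rem = r) :
    R.V L.flatten = addConst (slotSum T) (R.F12lo - (r + 126 * ((L.flatten.length : ℚ) / R.C.D))) := by
  unfold CertRow.V CertRow.rho
  rw [← hT, ← Cell.acc_coef_flatten, hr]; rfl

/-- The row check from kernel jobs with MATERIALISED slot lists: `hW`/`hV` are `decide`d list equalities. -/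
theorem CertRow.check_of_lit (R : CertRow) (vs : List (ℤ × ℤ × ℤ)) (h3 : (R.acc3 vs).ok = true)
    (h6 : (R.acc6 vs).ok = true)
    (hside : decide (R.C.J = 4 ∧ 0 < R.C.D ∧ R.C.h1 ≤ 1 ∧ R.C.h2 ≤ 1 ∧ R.C.h3 ≤ 1 ∧ R.C.h4 ≤ 1 ∧ R.C.h5 ≤ 1 ∧
      0 ≤ R.A ∧ 0 ≤ R.B ∧ R.P.dOK = true) = true)
    (W V : List ℚ) (hW : R.W vs = W) (hV : R.V vs = V) (hm : decide (0 ≤ R.marginOf W V) = true) :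
    R.check vs = true := by
  apply R.check_of vs h3 h6 hside
  rw [R.margin_eq, hW, hV]; exact hm

/-- Sharpness side: a materialised margin that is NEGATIVE makes the row check `false` (the cell is too wide for this certificate). -/
theorem CertRow.check_false_of_lit (R : CertRow) (vs : List (ℤ × ℤ × ℤ)) (W V : List ℚ) (hW : R.W vs = W) (hV : R.V vs = V)
    (hm : decide (0 ≤ R.marginOf W V) = false) : R.check vs = false := by
  have hm' : ¬ 0 ≤ R.margin vs := by
    rw [R.margin_eq, hW, hV]; exact of_decide_eq_false hm
  unfold CertRow.check
  exact decide_eq_false fun h => hm' h.2.2.2.2.2.2.2.2.2.2.2.2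

/-- `Cell.trueSum_nonneg` (docstring added by the landing lane; see the module docstring). [formal bookkeeping] -/
theorem Cell.trueSum_nonneg (C : Cell) (n : ℕ) (vs : List (ℤ × ℤ × ℤ)) (t1 t2 t3 t4 t5 : ℝ)
    (h1 : |t1| ≤ C.h1) (h2 : |t2| ≤ C.h2) (h3 : |t3| ≤ C.h3) (h4 : |t4| ≤ C.h4) (h5 : |t5| ≤ C.h5)
    (hadm : ∀ N ∈ vs, 0 < C.cOf N.1 N.2.1 N.2.2 ∧ C.UOf N.1 N.2.1 N.2.2 < 1 / 2) :
    0 ≤ C.trueSum n vs t1 t2 t3 t4 t5 := by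
  unfold Cell.trueSum
  apply List.sum_nonneg
  intro x hx
  rw [List.mem_map] at hx
  obtain ⟨N, hN, rfl⟩ := hx
  obtain ⟨hc, hU⟩ := hadm N hN
  have hl := C.linR_div_abs_le N.1 N.2.1 N.2.2 hc t1 t2 t3 t4 t5 h1 h2 h3 h4 h5
  have hc' : (0 : ℝ) < C.cOf N.1 N.2.1 N.2.2 := by exact_mod_cast hc
  have hU' : ((C.UOf N.1 N.2.1 N.2.2 : ℚ) : ℝ) < 1 / 2 := by
    have := (Rat.cast_lt (K := ℝ)).2 hU; simpa using this
  have hge : -(1 / 2 : ℝ) ≤ C.linR N.1 N.2.1 N.2.2 t1 t2 t3 t4 t5 / C.cOf N.1 N.2.1 N.2.2 := by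
    have := neg_abs_le (C.linR N.1 N.2.1 N.2.2 t1 t2 t3 t4 t5 / C.cOf N.1 N.2.1 N.2.2)
    linarith
  have hge' := (le_div_iff₀ hc').1 hge
  have hpos : 0 < (C.cOf N.1 N.2.1 N.2.2 : ℝ) + C.linR N.1 N.2.1 N.2.2 t1 t2 t3 t4 t5 := by linarith
  positivity

/-- SOUNDNESS OF THE CELL CHECK: `B·(Σ N^{-3}(t) + far₃)² ≤ A·(Σ N^{-6}(t) + far₆)` on the whole box. -/
theorem CertRow.check_sound (R : CertRow) (vs : List (ℤ × ℤ × ℤ)) (hchk : R.check vs = true)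
    (t1 t2 t3 t4 t5 : ℝ)
    (h1 : |t1| ≤ R.C.h1) (h2 : |t2| ≤ R.C.h2) (h3 : |t3| ≤ R.C.h3) (h4 : |t4| ≤ R.C.h4) (h5 : |t5| ≤ R.C.h5)
    (far3 far6 : ℝ) (hf3 : 0 ≤ far3) (hf3' : far3 ≤ R.F6hi) (hf6 : (R.F12lo : ℝ) ≤ far6) :
    (R.B : ℝ) * (R.C.trueSum 3 vs t1 t2 t3 t4 t5 + far3) ^ 2
      ≤ (R.A : ℝ) * (R.C.trueSum 6 vs t1 t2 t3 t4 t5 + far6) := by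
  have hc := of_decide_eq_true hchk
  obtain ⟨hok3, hok6, hJ, hD, hh1, hh2, hh3, hh4, hh5, hA, hB, hdOK, hmar⟩ := hc
  -- (1) the two accumulations are sound
  have s3 : |R.C.trueSum 3 vs t1 t2 t3 t4 t5 - evalCoef (R.acc3 vs).coef t1 t2 t3 t4 t5|
      ≤ (R.rho vs (R.acc3 vs) : ℝ) := by
    have := (R.C.withM 3).acc_sound_m3_J4 rfl hJ hD hh1 hh2 hh3 hh4 hh5 vs hok3 t1 t2 t3 t4 t5 h1 h2 h3 h4 h5
    refine this.trans (le_of_eq ?_)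
    simp only [CertRow.rho, CertRow.acc3]; rw [show (R.C.withM 3).D = R.C.D from rfl]; push_cast; ring
  have s6 : |R.C.trueSum 6 vs t1 t2 t3 t4 t5 - evalCoef (R.acc6 vs).coef t1 t2 t3 t4 t5|
      ≤ (R.rho vs (R.acc6 vs) : ℝ) := by
    have := (R.C.withM 6).acc_sound_m6_J4 rfl hJ hD hh1 hh2 hh3 hh4 hh5 vs hok6 t1 t2 t3 t4 t5 h1 h2 h3 h4 h5
    refine this.trans (le_of_eq ?_)
    simp only [CertRow.rho, CertRow.acc6]; rw [show (R.C.withM 6).D = R.C.D from rfl]; push_cast; ring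
  -- (2) the six-sum is nonnegative
  have hN3 : 0 ≤ R.C.trueSum 3 vs t1 t2 t3 t4 t5 :=
    R.C.trueSum_nonneg 3 vs t1 t2 t3 t4 t5 h1 h2 h3 h4 h5 (((R.C.withM 3).acc_ok_iff vs).1 hok3)
  -- (3) closed forms of the slot lists
  have hc3 := (R.C.withM 3).acc_coef vs
  have hc6 := (R.C.withM 6).acc_coef vs
  set g3 : Mono → ℚ := fun mo => (vs.map fun N => (R.C.withM 3).rc N mo).sum with hg3
  set g6 : Mono → ℚ := fun mo => (vs.map fun N => (R.C.withM 6).rc N mo).sum with hg6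
  change (R.acc3 vs).coef = monos.map g3 at hc3
  change (R.acc6 vs).coef = monos.map g6 at hc6
  -- W ⊒ six-sum, and 0 ≤ six ≤ W(t)
  have hW : evalCoef (R.W vs) t1 t2 t3 t4 t5
      = evalCoef (R.acc3 vs).coef t1 t2 t3 t4 t5 + ((R.rho vs (R.acc3 vs) + R.F6hi : ℚ) : ℝ) := by
    unfold CertRow.W; rw [hc3, evalCoef_addConst]
  have hSix0 : 0 ≤ R.C.trueSum 3 vs t1 t2 t3 t4 t5 + far3 := by linarith
  have hSixW : R.C.trueSum 3 vs t1 t2 t3 t4 t5 + far3 ≤ evalCoef (R.W vs) t1 t2 t3 t4 t5 := by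
    rw [hW]; push_cast
    have := (abs_le.1 s3).2
    have hf : far3 ≤ (R.F6hi : ℝ) := hf3'
    linarith
  have hSq : (R.C.trueSum 3 vs t1 t2 t3 t4 t5 + far3) ^ 2 ≤ (evalCoef (R.W vs) t1 t2 t3 t4 t5) ^ 2 :=
    pow_le_pow_left₀ hSix0 hSixW 2
  -- V ⊑ twelve-sum
  set fV : Mono → ℚ := fun mo => g6 mo + if mo.d = 0 then R.F12lo - R.rho vs (R.acc6 vs) else 0 with hfV
  have hVl : R.V vs = monos.map fV := by unfold CertRow.V; rw [hc6, addConst_map]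
  have hV : evalCoef (R.V vs) t1 t2 t3 t4 t5
      = evalCoef (R.acc6 vs).coef t1 t2 t3 t4 t5 + ((R.F12lo - R.rho vs (R.acc6 vs) : ℚ) : ℝ) := by
    unfold CertRow.V; rw [hc6, evalCoef_addConst]
  have hVT : evalCoef (R.V vs) t1 t2 t3 t4 t5 ≤ R.C.trueSum 6 vs t1 t2 t3 t4 t5 + far6 := by
    rw [hV]; push_cast
    have := (abs_le.1 s6).1
    linarith
  -- the product W·W
  have hprod := slotProd_sound R.C (R.W vs) (R.W vs) t1 t2 t3 t4 t5 h1 h2 h3 h4 h5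
  -- the certificate polynomial and its lower bound on the box
  set fQ : Mono → ℚ := fun mo => R.A * fV mo - R.B * slotProdCoef (R.W vs) (R.W vs) mo with hfQ
  have hQl : R.Q vs = monos.map fQ := by
    rw [CertRow.Q_eq, hVl]; unfold slotProd; rw [linComb_map]
  have hQe : evalCoef (R.Q vs) t1 t2 t3 t4 t5
      = R.A * evalCoef (R.V vs) t1 t2 t3 t4 t5 - R.B * evalCoef (slotProd (R.W vs) (R.W vs)) t1 t2 t3 t4 t5 := by
    rw [CertRow.Q_eq, hVl]; unfold slotProd; rw [evalCoef_linComb]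
  have hQge := evalCoef_map_ge R.C fQ t1 t2 t3 t4 t5 h1 h2 h3 h4 h5
  have hquad := (qfOf fQ).eval_ge_of_cert R.P hdOK R.C t1 t2 t3 t4 t5 h1 h2 h3 h4 h5
  rw [← hQl] at hQge
  -- the margin
  unfold CertRow.margin at hmar
  rw [slotProdDropF_eq, hQl, getZero_map, qfOfList_map, ← hQl] at hmar
  have hmar' : (0 : ℝ) ≤ (fQ slot0 : ℝ) - (cornerSum R.C (R.Q vs) : ℝ) - (((qfOf fQ).sub R.P.qf).boxLoss R.C : ℝ)
      - R.B * (slotProdDrop R.C (R.W vs) (R.W vs) : ℝ) := by exact_mod_cast hmar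
  -- assemble
  have hA' : (0 : ℝ) ≤ R.A := by exact_mod_cast hA
  have hB' : (0 : ℝ) ≤ R.B := by exact_mod_cast hB
  have hWW : (evalCoef (R.W vs) t1 t2 t3 t4 t5) ^ 2
      ≤ evalCoef (slotProd (R.W vs) (R.W vs)) t1 t2 t3 t4 t5 + (slotProdDrop R.C (R.W vs) (R.W vs) : ℝ) := by
    have := (abs_le.1 hprod).2
    nlinarith
  have k1 : (R.B : ℝ) * (R.C.trueSum 3 vs t1 t2 t3 t4 t5 + far3) ^ 2
      ≤ R.B * (evalCoef (slotProd (R.W vs) (R.W vs)) t1 t2 t3 t4 t5 + (slotProdDrop R.C (R.W vs) (R.W vs) : ℝ)) :=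
    mul_le_mul_of_nonneg_left (hSq.trans hWW) hB'
  have k2 : (R.A : ℝ) * evalCoef (R.V vs) t1 t2 t3 t4 t5 ≤ R.A * (R.C.trueSum 6 vs t1 t2 t3 t4 t5 + far6) :=
    mul_le_mul_of_nonneg_left hVT hA'
  linarith

end Summit.AtomisticToContinuum.Crystallization.Theorems.OverbindingBudgetAffineTaylorCell
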